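import Mathlib
import HarnessLib
import Literature.MathematicalPhysics.QuantumLattice.GaugeGroups
import Literature.LinearAlgebra.Matrix.UnitaryGroupMaximalTorus
import Literature.LinearAlgebra.Matrix.SpecialUnitaryGroupConjugacyClasses
import Summits.Ventures.LatticeQCDFlow.Exactness.TorusCircleChart
import Summits.Ventures.LatticeQCDFlow.Exactness.TorusCubeChart
import Summits.Ventures.LatticeQCDFlow.Exactness.TorusWeylSymmetry
import Summits.Ventures.LatticeQCDFlow.Exactness.SpectralKernelJacobianWeylShapeSU
import Summits.Ventures.LatticeQCDFlow.Exactness.SU3TorusChamberDecomposition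
import Summits.Ventures.LatticeQCDFlow.Exactness.SUNAlcoveFundamentalDomain

/-!
# Haar on the diagonal torus of `SU(N)` by Weyl chambers, every `N`: `Haar_{SΔ(n+1)} = Σ_{σ ∈ S_{n+1}} (P_σ ∘ E)_* ((2π)⁻ⁿ · Leb|_A)`

HONEST FRAMING: exact (Metropolis-corrected) sampling algorithms for lattice gauge theory;
figures of merit are autocorrelation/cost numbers at stated couplings and volumes; no
continuum-physics claim.

Venture `LatticeQCDFlow` (cell pub-lqcd), topic `Exactness`; FANOUT row 10 (`eng-equiv`, engine
`latflow.equiv` `spectral.py` general `N`; Boyda et al., PRD 103 (2021) 074504 §III.C, App. B).  NEW WORK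
of the cell: the every-`N` version of `SU3TorusChamberDecomposition.lean` over this row's
`SUNAlcoveFundamentalDomain.lean`, `TorusCubeChart.lean`, `TorusCircleChart.lean`, `TorusWeylSymmetry.lean`
and Mathlib (`Real.map_matrix_volume_pi_eq_smul_volume_pi`, `LinearMap.det`).  Nothing is cited as a
fact; no number; no definition (`E`, `P σ`, `C τ` through characterising hypotheses).

## What is typed (`x(θ) = Fin.snoc θ (−Σθ)`; `E θ = diag(e^{i x(θ)})`; `(P σ t)_ii = t_{σi σi}`; `L_σ θ = (x(θ)(σ k.castSucc))_k`)
* `exists_angleChart_sun`, `angleChart_sun_eq_of_exp_eq`, `angleChart_sun_add`, `angleChart_sun_intMul_add`,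
  **`haarProbability_sunTorus_eq_map_cube`** (`Haar_{SΔ(n+1)} = (2π)⁻ⁿ · E_* Leb|_{(−π,π]ⁿ}`);
* `phases_sun_perm`, **`permDiag_angleChart_sun`** (`P σ ∘ E = E ∘ L_σ`), `preimage_chamber_perm_sun`,
  `linPerm_toLin'`, `linPerm_comp`, `linPerm_pow`, **`map_linPerm_volume_sun`** (`L_σ^{(n+1)!} = id ⇒ |det L_σ| = 1`);
* **`haarProbability_sunTorus_eq_sum_chambers`** — `Haar_{SΔ(n+1)} = Σ_{σ ∈ S_{n+1}} (P σ)_* ((2π)⁻ⁿ · E_* Leb|_{C 1})`.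

NOT here: the cell charts `φ_N`, `ζ_N` and the `hfJ` assembly (`SUNTorusAlcoveJacobian.lean`); any number. -/

noncomputable section

namespace Summit.Ventures.LatticeQCDFlow.Exactness

open MeasureTheory Matrix Set Real
open Literature.LinearAlgebra.Matrix
open Literature.MathematicalPhysics.QuantumFieldTheory (haarProbability)
open scoped ENNReal

variable {n : ℕ}

/-- Products of `e^{iθ_k}` in `ℂ`: `∏_{k ∈ s} e^{iθ_k} = e^{i Σ_{k ∈ s} θ_k}`. -/
theorem prod_coe_exp_eq_coe_exp_sum {ι : Type*} [DecidableEq ι] (s : Finset ι) (θ : ι → ℝ) :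
    ∏ k ∈ s, (Circle.exp (θ k) : ℂ) = (Circle.exp (∑ k ∈ s, θ k) : ℂ) := by
  induction s using Finset.induction_on with
  | empty => simp
  | insert a s ha ih => rw [Finset.prod_insert ha, Finset.sum_insert ha, ih, Circle.exp_add, Circle.coe_mul]

/-- The phases are additive in the free phases. -/
theorem phases_sun_add (θ θ' : Fin n → ℝ) (i : Fin (n + 1)) :
    (Fin.snoc (θ + θ') (-∑ k, (θ + θ') k) : Fin (n + 1) → ℝ) i =
      (Fin.snoc θ (-∑ k, θ k) : Fin (n + 1) → ℝ) i + (Fin.snoc θ' (-∑ k, θ' k) : Fin (n + 1) → ℝ) i := by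
  induction i using Fin.lastCases with
  | last => simp only [Fin.snoc_last, Pi.add_apply, Finset.sum_add_distrib]; ring
  | cast k => simp only [Fin.snoc_castSucc, Pi.add_apply]

/-- `diag(e^{i x(θ)}) ∈ SU(n+1)`. -/
theorem diagonal_phases_sun_mem (θ : Fin n → ℝ) :
    diagonal (fun i => (Circle.exp ((Fin.snoc θ (-∑ k, θ k) : Fin (n + 1) → ℝ) i) : ℂ)) ∈
      Matrix.specialUnitaryGroup (Fin (n + 1)) ℂ := by
  refine (Literature.MathematicalPhysics.QuantumLattice.diagonal_mem_specialUnitaryGroup_iff _).mpr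
    ⟨fun i => Circle.norm_coe _, ?_⟩
  rw [prod_coe_exp_eq_coe_exp_sum, sum_phases_sun, Circle.exp_zero, Circle.coe_one]

/-- **The angle chart of `SΔ(n+1)` exists and is continuous.** -/
theorem exists_angleChart_sun :
    ∃ E : (Fin n → ℝ) → specialDiagonalTorus (Fin (n + 1)), Continuous E ∧
      ∀ θ (i : Fin (n + 1)), (((E θ : specialDiagonalTorus (Fin (n + 1))) : Matrix.specialUnitaryGroup (Fin (n + 1)) ℂ) :
        Matrix (Fin (n + 1)) (Fin (n + 1)) ℂ) i i = (Circle.exp ((Fin.snoc θ (-∑ k, θ k) : Fin (n + 1) → ℝ) i) : ℂ) := by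
  refine ⟨fun θ => ⟨⟨diagonal (fun i => (Circle.exp ((Fin.snoc θ (-∑ k, θ k) : Fin (n + 1) → ℝ) i) : ℂ)),
    diagonal_phases_sun_mem θ⟩, ⟨_, rfl⟩⟩, ?_, fun θ i => ?_⟩
  · refine continuous_induced_rng.2 (continuous_induced_rng.2 ?_)
    change Continuous fun θ : Fin n → ℝ =>
      diagonal (fun i => (Circle.exp ((Fin.snoc θ (-∑ k, θ k) : Fin (n + 1) → ℝ) i) : ℂ))
    exact (continuous_pi fun i => continuous_subtype_val.comp
      (Circle.exp.continuous.comp ((continuous_apply i).comp continuous_phases_sun))).matrix_diagonal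
  · change (diagonal (fun i => (Circle.exp ((Fin.snoc θ (-∑ k, θ k) : Fin (n + 1) → ℝ) i) : ℂ))) i i = _
    rw [diagonal_apply_eq]

section Chart

variable {E : (Fin n → ℝ) → specialDiagonalTorus (Fin (n + 1))}
  (hE : ∀ θ (i : Fin (n + 1)), (((E θ : specialDiagonalTorus (Fin (n + 1))) : Matrix.specialUnitaryGroup (Fin (n + 1)) ℂ) :
    Matrix (Fin (n + 1)) (Fin (n + 1)) ℂ) i i = (Circle.exp ((Fin.snoc θ (-∑ k, θ k) : Fin (n + 1) → ℝ) i) : ℂ))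

include hE

/-- The matrix of `E θ` is `diag(e^{i x(θ)})`. -/
theorem coe_angleChart_sun (θ : Fin n → ℝ) :
    (((E θ : specialDiagonalTorus (Fin (n + 1))) : Matrix.specialUnitaryGroup (Fin (n + 1)) ℂ) :
      Matrix (Fin (n + 1)) (Fin (n + 1)) ℂ) =
      diagonal (fun i => (Circle.exp ((Fin.snoc θ (-∑ k, θ k) : Fin (n + 1) → ℝ) i) : ℂ)) := by
  rw [coe_specialDiagonalTorus_eq_diagonal (E θ)]
  exact congrArg diagonal (funext fun i => hE θ i)

/-- **The angle chart is continuous and measurable.** -/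
theorem continuous_measurable_angleChart_sun :
    Continuous (E : (Fin n → ℝ) → specialDiagonalTorus (Fin (n + 1))) ∧ Measurable E := by
  haveI : SecondCountableTopology (specialDiagonalTorus (Fin (n + 1))) := secondCountableTopology_specialDiagonalTorus
  refine (fun h : Continuous E => ⟨h, h.measurable⟩) ?_
  refine continuous_induced_rng.2 (continuous_induced_rng.2 ?_)
  have hfun : (fun θ => (((E θ : specialDiagonalTorus (Fin (n + 1))) : Matrix.specialUnitaryGroup (Fin (n + 1)) ℂ) :
      Matrix (Fin (n + 1)) (Fin (n + 1)) ℂ)) =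
      fun θ : Fin n → ℝ => diagonal (fun i => (Circle.exp ((Fin.snoc θ (-∑ k, θ k) : Fin (n + 1) → ℝ) i) : ℂ)) :=
    funext fun θ => coe_angleChart_sun hE θ
  change Continuous fun θ => (((E θ : specialDiagonalTorus (Fin (n + 1))) :
    Matrix.specialUnitaryGroup (Fin (n + 1)) ℂ) : Matrix (Fin (n + 1)) (Fin (n + 1)) ℂ)
  rw [hfun]
  exact (continuous_pi fun i => continuous_subtype_val.comp
    (Circle.exp.continuous.comp ((continuous_apply i).comp continuous_phases_sun))).matrix_diagonal

/-- **The angle chart only sees the free phases modulo `2π`.** -/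
theorem angleChart_sun_eq_of_exp_eq {θ θ' : Fin n → ℝ} (h : ∀ k, Circle.exp (θ k) = Circle.exp (θ' k)) : E θ = E θ' := by
  refine specialDiagonalTorus_ext fun i => ?_
  rw [hE, hE]
  induction i using Fin.lastCases with
  | last =>
    simp only [Fin.snoc_last, Circle.exp_neg, Circle.coe_inv, ← prod_coe_exp_eq_coe_exp_sum, h]
  | cast k => rw [Fin.snoc_castSucc, Fin.snoc_castSucc, h]

/-- **The angle chart is additive**: `E (θ + θ') = E θ · E θ'`. -/
theorem angleChart_sun_add (θ θ' : Fin n → ℝ) : E (θ + θ') = E θ * E θ' := by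
  refine specialDiagonalTorus_ext fun i => ?_
  have hmul : (((E θ * E θ' : specialDiagonalTorus (Fin (n + 1))) : Matrix.specialUnitaryGroup (Fin (n + 1)) ℂ) :
      Matrix (Fin (n + 1)) (Fin (n + 1)) ℂ) =
      (((E θ : specialDiagonalTorus (Fin (n + 1))) : Matrix.specialUnitaryGroup (Fin (n + 1)) ℂ) :
        Matrix (Fin (n + 1)) (Fin (n + 1)) ℂ) *
        (((E θ' : specialDiagonalTorus (Fin (n + 1))) : Matrix.specialUnitaryGroup (Fin (n + 1)) ℂ) :
          Matrix (Fin (n + 1)) (Fin (n + 1)) ℂ) :=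
    rfl
  rw [hmul, coe_angleChart_sun hE, coe_angleChart_sun hE, coe_angleChart_sun hE, diagonal_mul_diagonal,
    diagonal_apply_eq, diagonal_apply_eq, ← Circle.coe_mul, ← Circle.exp_add, phases_sun_add]

/-- **Lattice periodicity** of the angle chart. -/
theorem angleChart_sun_intMul_add (m : Fin n → ℤ) (θ : Fin n → ℝ) :
    E ((fun k => (m k : ℝ) * (2 * π)) + θ) = E θ :=
  angleChart_sun_eq_of_exp_eq hE fun k => by
    simp only [Pi.add_apply, Circle.exp_add, Circle.exp_int_mul_two_pi, one_mul]

/-- **`Haar_{SΔ(n+1)}` in the free angle coordinates**: `Haar_{SΔ(n+1)} = (2π)⁻ⁿ · E_* Leb|_{(−π, π]ⁿ}`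
(uniqueness of Haar through the measurable surjective homomorphism `z ↦ E(arg z)` from `U(1)ⁿ`). -/
theorem haarProbability_sunTorus_eq_map_cube :
    haarProbability (specialDiagonalTorus (Fin (n + 1))) = ((ENNReal.ofReal (2 * π)) ^ n)⁻¹ •
      Measure.map E ((volume : Measure (Fin n → ℝ)).restrict (Set.pi Set.univ fun _ : Fin n => Ioc (-π) π)) := by
  haveI : SecondCountableTopology (specialDiagonalTorus (Fin (n + 1))) := secondCountableTopology_specialDiagonalTorus
  have hEm : Measurable E := (continuous_measurable_angleChart_sun hE).2
  have hargm : Measurable fun z : Fin n → Circle => fun k => Complex.arg (z k : ℂ) := by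
    refine measurable_pi_lambda _ fun k => ?_
    have hk : Measurable fun z : Fin n → Circle => z k := measurable_pi_apply k
    have hc : Continuous fun z : Circle => (z : ℂ) := continuous_subtype_val
    exact Complex.measurable_arg.comp (hc.measurable.comp hk)
  have hmeas : Measurable fun z : Fin n → Circle => E fun k => Complex.arg (z k : ℂ) := hEm.comp hargm
  have hmul : ∀ z w : Fin n → Circle, E (fun k => Complex.arg ((z * w) k : ℂ)) =
      E (fun k => Complex.arg (z k : ℂ)) * E (fun k => Complex.arg (w k : ℂ)) := by
    intro z w
    rw [← angleChart_sun_add hE]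
    exact angleChart_sun_eq_of_exp_eq hE fun k => by
      simp only [Pi.mul_apply, Pi.add_apply, Circle.exp_add, Circle.exp_arg]
  have hsurj : Function.Surjective fun z : Fin n → Circle => E fun k => Complex.arg (z k : ℂ) := by
    intro t
    have hd1 : ∀ i, ‖((t : Matrix.specialUnitaryGroup (Fin (n + 1)) ℂ) : Matrix (Fin (n + 1)) (Fin (n + 1)) ℂ) i i‖ = 1 :=
      norm_specialDiagonalTorus_apply t
    have hprod : (∏ k : Fin n, ((t : Matrix.specialUnitaryGroup (Fin (n + 1)) ℂ) : Matrix (Fin (n + 1)) (Fin (n + 1)) ℂ)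
        k.castSucc k.castSucc) *
        ((t : Matrix.specialUnitaryGroup (Fin (n + 1)) ℂ) : Matrix (Fin (n + 1)) (Fin (n + 1)) ℂ) (Fin.last n) (Fin.last n) = 1 := by
      have h := (norm_eq_one_and_prod_eq_one_of_mem_specialDiagonalTorus (coe_specialDiagonalTorus_eq_diagonal t)).2
      rw [Fin.prod_univ_castSucc] at h
      exact h
    set c : Fin n → Circle := fun k => ⟨((t : Matrix.specialUnitaryGroup (Fin (n + 1)) ℂ) :
      Matrix (Fin (n + 1)) (Fin (n + 1)) ℂ) k.castSucc k.castSucc, mem_sphere_zero_iff_norm.mpr (hd1 _)⟩ with hc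
    have hlast : ((t : Matrix.specialUnitaryGroup (Fin (n + 1)) ℂ) : Matrix (Fin (n + 1)) (Fin (n + 1)) ℂ)
        (Fin.last n) (Fin.last n) = (∏ k : Fin n, (c k : ℂ))⁻¹ := by
      have hc' : (∏ k : Fin n, (c k : ℂ)) = ∏ k : Fin n, ((t : Matrix.specialUnitaryGroup (Fin (n + 1)) ℂ) :
          Matrix (Fin (n + 1)) (Fin (n + 1)) ℂ) k.castSucc k.castSucc := rfl
      rw [hc']
      exact eq_inv_of_mul_eq_one_right hprod
    refine ⟨c, specialDiagonalTorus_ext fun i => ?_⟩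
    change ((((E fun k => Complex.arg ((c k : Circle) : ℂ)) : specialDiagonalTorus (Fin (n + 1))) :
      Matrix.specialUnitaryGroup (Fin (n + 1)) ℂ) : Matrix (Fin (n + 1)) (Fin (n + 1)) ℂ) i i =
        ((t : Matrix.specialUnitaryGroup (Fin (n + 1)) ℂ) : Matrix (Fin (n + 1)) (Fin (n + 1)) ℂ) i i
    rw [hE]
    induction i using Fin.lastCases with
    | last =>
      rw [Fin.snoc_last, Circle.exp_neg, Circle.coe_inv, ← prod_coe_exp_eq_coe_exp_sum, hlast]
      congr 1
      exact Finset.prod_congr rfl fun k _ => by rw [Circle.exp_arg]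
    | cast k =>
      rw [Fin.snoc_castSucc, Circle.exp_arg]
  have hpres := map_eq_haarProbability_of_mul_of_surjective
    (Measure.pi fun _ : Fin n => haarProbability Circle) hmeas hmul hsurj
  have hcomp : (fun z : Fin n → Circle => E fun k => Complex.arg (z k : ℂ)) ∘
      (fun θ : Fin n → ℝ => fun k => Circle.exp (θ k)) = E := by
    funext θ
    simp only [Function.comp_apply]
    exact angleChart_sun_eq_of_exp_eq hE fun k => by rw [Circle.exp_arg]
  rw [← hpres, pi_haarProbability_circle_eq_map_cube, Measure.map_smul, Measure.map_map hmeas measurable_cubeExp,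
    hcomp, Fintype.card_fin, ← Measure.restrict_pi_pi, ← volume_pi]

end Chart

/-- **A permutation of the phases, read on the free phases**: the phases of `L_σ θ = (x(θ)(σ k.castSucc))_k`
are `x(θ) ∘ σ` (the last one by `Σ = 0`). -/
theorem phases_sun_perm (σ : Equiv.Perm (Fin (n + 1))) (θ : Fin n → ℝ) (i : Fin (n + 1)) :
    (Fin.snoc (fun k : Fin n => (Fin.snoc θ (-∑ k, θ k) : Fin (n + 1) → ℝ) (σ k.castSucc))
        (-∑ k : Fin n, (Fin.snoc θ (-∑ k, θ k) : Fin (n + 1) → ℝ) (σ k.castSucc)) : Fin (n + 1) → ℝ) i =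
      (Fin.snoc θ (-∑ k, θ k) : Fin (n + 1) → ℝ) (σ i) := by
  induction i using Fin.lastCases with
  | last =>
    rw [Fin.snoc_last]
    have hsum : ∑ j, (Fin.snoc θ (-∑ k, θ k) : Fin (n + 1) → ℝ) (σ j) = 0 := by
      rw [Equiv.sum_comp σ (fun j => (Fin.snoc θ (-∑ k, θ k) : Fin (n + 1) → ℝ) j)]
      exact sum_phases_sun θ
    rw [Fin.sum_univ_castSucc] at hsum
    linarith
  | cast k => rw [Fin.snoc_castSucc]

/-- The matrix of `L_σ`: `(L_σ)_{kj} = −1` if `σ(k) = last`, `1` if `σ(k) = j`, `0` otherwise. -/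
theorem linPerm_toLin' (σ : Equiv.Perm (Fin (n + 1))) (θ : Fin n → ℝ) :
    Matrix.toLin' (Matrix.of fun k j : Fin n =>
        if σ k.castSucc = Fin.last n then (-1 : ℝ) else if σ k.castSucc = j.castSucc then 1 else 0) θ =
      fun k : Fin n => (Fin.snoc θ (-∑ k, θ k) : Fin (n + 1) → ℝ) (σ k.castSucc) := by
  funext k
  rw [Matrix.toLin'_apply, Matrix.mulVec, dotProduct]
  simp only [Matrix.of_apply]
  rcases Fin.eq_castSucc_or_eq_last (σ k.castSucc) with ⟨j₀, hj₀⟩ | hlast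
  · rw [hj₀, Fin.snoc_castSucc]
    have hne : j₀.castSucc ≠ Fin.last n := (Fin.castSucc_lt_last j₀).ne
    simp only [hne, if_false, Fin.castSucc_inj, ite_mul, one_mul, zero_mul, Finset.sum_ite_eq, Finset.mem_univ, if_true]
  · rw [hlast, Fin.snoc_last]
    simp only [if_true, neg_mul, one_mul, Finset.sum_neg_distrib]

/-- **Composition law**: `L_τ ∘ L_σ = L_{στ}`. -/
theorem linPerm_comp (σ τ : Equiv.Perm (Fin (n + 1))) :
    Matrix.toLin' (Matrix.of fun k j : Fin n =>
        if τ k.castSucc = Fin.last n then (-1 : ℝ) else if τ k.castSucc = j.castSucc then 1 else 0) ∘ₗ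
      Matrix.toLin' (Matrix.of fun k j : Fin n =>
        if σ k.castSucc = Fin.last n then (-1 : ℝ) else if σ k.castSucc = j.castSucc then 1 else 0) =
      Matrix.toLin' (Matrix.of fun k j : Fin n =>
        if (σ * τ) k.castSucc = Fin.last n then (-1 : ℝ) else if (σ * τ) k.castSucc = j.castSucc then 1 else 0) := by
  refine LinearMap.ext fun θ => ?_
  rw [LinearMap.comp_apply, linPerm_toLin', linPerm_toLin', linPerm_toLin']
  funext k
  rw [phases_sun_perm, Equiv.Perm.mul_apply]

/-- **Powers**: `L_σ^m = L_{σ^m}` in `End(ℝⁿ)`. -/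
theorem linPerm_pow (σ : Equiv.Perm (Fin (n + 1))) (m : ℕ) :
    (Matrix.toLin' (Matrix.of fun k j : Fin n =>
        if σ k.castSucc = Fin.last n then (-1 : ℝ) else if σ k.castSucc = j.castSucc then 1 else 0)) ^ m =
      Matrix.toLin' (Matrix.of fun k j : Fin n =>
        if (σ ^ m) k.castSucc = Fin.last n then (-1 : ℝ) else if (σ ^ m) k.castSucc = j.castSucc then 1 else 0) := by
  induction m with
  | zero =>
    refine LinearMap.ext fun θ => ?_
    rw [pow_zero, pow_zero, Module.End.one_apply, linPerm_toLin']
    funext k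
    rw [Equiv.Perm.one_apply, Fin.snoc_castSucc]
  | succ m ih =>
    rw [pow_succ, ih, Module.End.mul_eq_comp, linPerm_comp, ← pow_succ']

/-- **`L_σ` preserves Lebesgue measure**: `L_σ^{(n+1)!} = id` forces `|det L_σ| = 1`. -/
theorem map_linPerm_volume_sun (σ : Equiv.Perm (Fin (n + 1))) :
    Measure.map (fun θ : Fin n → ℝ => fun k : Fin n => (Fin.snoc θ (-∑ k, θ k) : Fin (n + 1) → ℝ) (σ k.castSucc))
      (volume : Measure (Fin n → ℝ)) = volume := by
  set M : Matrix (Fin n) (Fin n) ℝ := Matrix.of fun k j : Fin n =>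
    if σ k.castSucc = Fin.last n then (-1 : ℝ) else if σ k.castSucc = j.castSucc then 1 else 0 with hM
  have hfun : (Matrix.toLin' M : (Fin n → ℝ) → (Fin n → ℝ)) =
      fun θ : Fin n → ℝ => fun k : Fin n => (Fin.snoc θ (-∑ k, θ k) : Fin (n + 1) → ℝ) (σ k.castSucc) :=
    funext (linPerm_toLin' σ)
  -- `L_σ ^ |S_{n+1}| = 1`
  have hpow : (Matrix.toLin' M) ^ Fintype.card (Equiv.Perm (Fin (n + 1))) = 1 := by
    rw [hM, linPerm_pow, pow_card_eq_one]
    refine LinearMap.ext fun θ => ?_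
    rw [Module.End.one_apply, linPerm_toLin']
    funext k
    rw [Equiv.Perm.one_apply, Fin.snoc_castSucc]
  have hdetpow : (LinearMap.det (Matrix.toLin' M)) ^ Fintype.card (Equiv.Perm (Fin (n + 1))) = 1 := by
    rw [← map_pow, hpow, map_one]
  have habs : |M.det| = 1 := by
    rw [← LinearMap.det_toLin']
    have h := congrArg (fun r : ℝ => |r|) hdetpow
    simp only [abs_pow, abs_one] at h
    exact (pow_eq_one_iff_of_nonneg (abs_nonneg _) Fintype.card_ne_zero).mp h
  have hdet : M.det ≠ 0 := fun h => by simp [h] at habs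
  rw [← hfun, Real.map_matrix_volume_pi_eq_smul_volume_pi hdet, abs_inv, habs, inv_one, ENNReal.ofReal_one, one_smul]

section Perm

variable {E : (Fin n → ℝ) → specialDiagonalTorus (Fin (n + 1))}
  (hE : ∀ θ (i : Fin (n + 1)), (((E θ : specialDiagonalTorus (Fin (n + 1))) : Matrix.specialUnitaryGroup (Fin (n + 1)) ℂ) :
    Matrix (Fin (n + 1)) (Fin (n + 1)) ℂ) i i = (Circle.exp ((Fin.snoc θ (-∑ k, θ k) : Fin (n + 1) → ℝ) i) : ℂ))
  {P : Equiv.Perm (Fin (n + 1)) → specialDiagonalTorus (Fin (n + 1)) → specialDiagonalTorus (Fin (n + 1))}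
  (hP : ∀ σ t i, (((P σ t : specialDiagonalTorus (Fin (n + 1))) : Matrix.specialUnitaryGroup (Fin (n + 1)) ℂ) :
    Matrix (Fin (n + 1)) (Fin (n + 1)) ℂ) i i =
      ((t : Matrix.specialUnitaryGroup (Fin (n + 1)) ℂ) : Matrix (Fin (n + 1)) (Fin (n + 1)) ℂ) (σ i) (σ i))

include hE hP

/-- **The phase permutation on the chart is the linear map `L_σ`**: `P σ (E θ) = E (L_σ θ)`. -/
theorem permDiag_angleChart_sun (σ : Equiv.Perm (Fin (n + 1))) (θ : Fin n → ℝ) :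
    P σ (E θ) = E (fun k : Fin n => (Fin.snoc θ (-∑ k, θ k) : Fin (n + 1) → ℝ) (σ k.castSucc)) := by
  refine specialDiagonalTorus_ext fun i => ?_
  rw [hP, hE, hE, phases_sun_perm]

end Perm

section Chambers

variable {C : Equiv.Perm (Fin (n + 1)) → Set (Fin n → ℝ)}
  (hC : ∀ τ θ, θ ∈ C τ ↔
    StrictMono ((Fin.snoc θ (-∑ k, θ k) : Fin (n + 1) → ℝ) ∘ τ) ∧
      (Fin.snoc θ (-∑ k, θ k) : Fin (n + 1) → ℝ) (τ (Fin.last n)) <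
        (Fin.snoc θ (-∑ k, θ k) : Fin (n + 1) → ℝ) (τ 0) + 2 * π)

include hC

/-- **`L_σ⁻¹ (C τ) = C (σ τ)`.** -/
theorem preimage_chamber_perm_sun (σ τ : Equiv.Perm (Fin (n + 1))) :
    (fun θ : Fin n → ℝ => fun k : Fin n => (Fin.snoc θ (-∑ k, θ k) : Fin (n + 1) → ℝ) (σ k.castSucc)) ⁻¹' C τ =
      C (σ * τ) := by
  ext θ
  have hx : (Fin.snoc (fun k : Fin n => (Fin.snoc θ (-∑ k, θ k) : Fin (n + 1) → ℝ) (σ k.castSucc))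
      (-∑ k : Fin n, (Fin.snoc θ (-∑ k, θ k) : Fin (n + 1) → ℝ) (σ k.castSucc)) : Fin (n + 1) → ℝ) =
      (Fin.snoc θ (-∑ k, θ k) : Fin (n + 1) → ℝ) ∘ σ :=
    funext (phases_sun_perm σ θ)
  rw [Set.mem_preimage, hC, hC, hx, Equiv.Perm.coe_mul]
  simp only [Function.comp_apply]
  exact Iff.rfl

end Chambers

section Decomposition

variable {E : (Fin n → ℝ) → specialDiagonalTorus (Fin (n + 1))}
  (hE : ∀ θ (i : Fin (n + 1)), (((E θ : specialDiagonalTorus (Fin (n + 1))) : Matrix.specialUnitaryGroup (Fin (n + 1)) ℂ) :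
    Matrix (Fin (n + 1)) (Fin (n + 1)) ℂ) i i = (Circle.exp ((Fin.snoc θ (-∑ k, θ k) : Fin (n + 1) → ℝ) i) : ℂ))
  {P : Equiv.Perm (Fin (n + 1)) → specialDiagonalTorus (Fin (n + 1)) → specialDiagonalTorus (Fin (n + 1))}
  (hP : ∀ σ t i, (((P σ t : specialDiagonalTorus (Fin (n + 1))) : Matrix.specialUnitaryGroup (Fin (n + 1)) ℂ) :
    Matrix (Fin (n + 1)) (Fin (n + 1)) ℂ) i i =
      ((t : Matrix.specialUnitaryGroup (Fin (n + 1)) ℂ) : Matrix (Fin (n + 1)) (Fin (n + 1)) ℂ) (σ i) (σ i))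
  {C : Equiv.Perm (Fin (n + 1)) → Set (Fin n → ℝ)}
  (hC : ∀ τ θ, θ ∈ C τ ↔
    StrictMono ((Fin.snoc θ (-∑ k, θ k) : Fin (n + 1) → ℝ) ∘ τ) ∧
      (Fin.snoc θ (-∑ k, θ k) : Fin (n + 1) → ℝ) (τ (Fin.last n)) <
        (Fin.snoc θ (-∑ k, θ k) : Fin (n + 1) → ℝ) (τ 0) + 2 * π)

include hE hP hC

/-- **Haar on the diagonal torus of `SU(N)` by Weyl chambers, every `N = n + 1`.**  With the angle
chart `E`, the phase permutations `P σ` and the alcove `A = C 1` (the sorted chamber) in free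
eigen-phases:  `Haar_{SΔ(n+1)} = Σ_{σ ∈ S_{n+1}} (P σ)_* ((2π)⁻ⁿ · E_* Leb|_A)` — the hypothesis `hdecomp`
of `hasJacobian_of_symmetric_pieces'` for the engine's general-`N` kernel. -/
theorem haarProbability_sunTorus_eq_sum_chambers :
    haarProbability (specialDiagonalTorus (Fin (n + 1))) =
      ∑ σ : Equiv.Perm (Fin (n + 1)), Measure.map (P σ)
        (((ENNReal.ofReal (2 * π)) ^ n)⁻¹ • Measure.map E ((volume : Measure (Fin n → ℝ)).restrict (C 1))) := by
  haveI : SecondCountableTopology (specialDiagonalTorus (Fin (n + 1))) := secondCountableTopology_specialDiagonalTorus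
  have hEm : Measurable E := (continuous_measurable_angleChart_sun hE).2
  have hPm : ∀ σ, Measurable (P σ) := fun σ => (permDiag_surjective_continuous (hP σ)).2.measurable
  have hLm : ∀ σ : Equiv.Perm (Fin (n + 1)), Measurable fun θ : Fin n → ℝ => fun k : Fin n =>
      (Fin.snoc θ (-∑ k, θ k) : Fin (n + 1) → ℝ) (σ k.castSucc) :=
    fun σ => measurable_pi_lambda _ fun k => (continuous_apply (σ k.castSucc)).measurable.comp continuous_phases_sun.measurable
  have hCm : ∀ τ, MeasurableSet (C τ) := measurableSet_chamber_sun hC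
  rw [haarProbability_sunTorus_eq_map_cube hE]
  ext B hB
  have hS : MeasurableSet (E ⁻¹' B) := hEm hB
  have hinv : ∀ m : Fin n → ℤ, (fun θ : Fin n → ℝ => (fun k => (m k : ℝ) * (2 * π)) + θ) ⁻¹' (E ⁻¹' B) = E ⁻¹' B := by
    intro m
    ext θ
    simp only [Set.mem_preimage, angleChart_sun_intMul_add hE]
  rw [Measure.smul_apply, Measure.map_apply hEm hB, Measure.restrict_apply hS,
    volume_inter_cube_eq_sum_chambers_sun hC hS hinv, Measure.coe_finsetSum, Finset.sum_apply, smul_eq_mul,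
    Finset.mul_sum]
  have hterm : ∀ σ : Equiv.Perm (Fin (n + 1)),
      (Measure.map (P σ) (((ENNReal.ofReal (2 * π)) ^ n)⁻¹ •
        Measure.map E ((volume : Measure (Fin n → ℝ)).restrict (C 1)))) B =
        ((ENNReal.ofReal (2 * π)) ^ n)⁻¹ * volume (E ⁻¹' B ∩ C σ⁻¹) := by
    intro σ
    rw [Measure.map_apply (hPm σ) hB, Measure.smul_apply, Measure.map_apply hEm (hPm σ hB), smul_eq_mul,
      Measure.restrict_apply (hEm (hPm σ hB))]
    congr 1
    have hset : E ⁻¹' (P σ ⁻¹' B) ∩ C 1 =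
        (fun θ : Fin n → ℝ => fun k : Fin n => (Fin.snoc θ (-∑ k, θ k) : Fin (n + 1) → ℝ) (σ k.castSucc)) ⁻¹'
          (E ⁻¹' B ∩ C σ⁻¹) := by
      rw [Set.preimage_inter, preimage_chamber_perm_sun hC σ σ⁻¹, mul_inv_cancel]
      congr 1
      ext θ
      simp only [Set.mem_preimage, permDiag_angleChart_sun hE hP]
    rw [hset, ← Measure.map_apply (hLm σ) (hS.inter (hCm _)), map_linPerm_volume_sun]
  simp_rw [hterm]
  exact Fintype.sum_equiv (Equiv.inv (Equiv.Perm (Fin (n + 1)))) _ _ fun σ => rfl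

end Decomposition

end Summit.Ventures.LatticeQCDFlow.Exactness
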